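import Literature.Analysis.FluidPDE.TaoCascadeRescaledBootstrap
import Mathlib.Analysis.SpecialFunctions.Log.Basic
import HarnessLib

/-!
# Tao's cascade ODE, proof of Prop. 6.5 — III: closing the exits (§6.5, second half)

T. Tao, *Finite time blowup for an averaged three-dimensional Navier–Stokes equation*,
J. Amer. Math. Soc. 29 (2016), 601–674 (arXiv:1402.0290v3), §6.5, pp. 35–36. Continuation of
`TaoCascadeRescaledBootstrap.lean` (hypotheses `RescaledHypotheses γ` of Prop. 6.5, bootstrap
regime `GoodAt`, time `T1`). Proved here:

* **Lemma 6.9 (almost all energy in primary modes)**: for `k ∈ {-1,0,1}` and `0 ≤ t ≤ T₁`,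
  `0 ≤ Ẽ_k(t) - ½(a_k²+b_k²+c_k²+d_k²)(t) ≤ primaryDefect ε₀ C₂ C₃ n₀`
  (an explicit `O((1+ε₀)^{-n₀/2})`);
* **Lemma 6.10 (closing some exits)**: at any `T ∈ [0, T₁]` the far energy conditions and the
  condition `Ẽ_0 + Ẽ_1 ≤ 1` hold strictly, under the explicit largeness `ε₀ K⁴ ≥ 10⁸`;
* **Corollary 6.11 (exit trichotomy)**: `T₁ = 100`, or `Ẽ_{-1}(T₁) = K^{-10}(1+ε₀)^{2/10}`, or
  `|d_1(T₁)| = ½K^{-10}`.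

Prop. 6.12 (the reduced claim) and the reduction Prop. 6.5 ⇐ Prop. 6.12 follow in
`TaoCascadeReducedClaim.lean`. Display labels (6.N) are the ordinal convention of the older
`TaoCascade*` files (offset `+2` = arXiv v3 numbering); authoritative locators are lemma numbers.

## References

* T. Tao, J. Amer. Math. Soc. 29 (2016), 601–674, §6.5 Lemmas 6.9, 6.10, Cor. 6.11.
  [`Tao2016AveragedNS`]
-/

noncomputable section

open Set MeasureTheory intervalIntegral Filter Topology
open scoped Interval
open Literature.Analysis.ODE

namespace Literature.Analysis.FluidPDE

namespace TaoCascade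

/-! ## A numerical inequality for `(1+ε₀)^{-p}` -/

/-- For `0 < ε₀ ≤ 1` and `0 < p ≤ 1`: `(1+ε₀)^{-p} ≤ 1 - p ε₀ / 4` (the quantitative form of
"`K` is large depending on `ε₀`" used to absorb the factors `(1+ε₀)^{-0.08}`, `(1+ε₀)^{-9.98}`
of Lemma 6.8 in Lemma 6.10). [folklore] -/
theorem rpow_neg_le_one_sub {ε₀ p : ℝ} (hε₀ : 0 < ε₀) (hε₀1 : ε₀ ≤ 1) (hp : 0 < p)
    (hp1 : p ≤ 1) : (1 + ε₀) ^ (-p) ≤ 1 - p * ε₀ / 4 := by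
  have hq : 0 < 1 + ε₀ := by linarith
  have hlog : ε₀ / 2 ≤ Real.log (1 + ε₀) := by
    have h1 := Real.one_sub_inv_le_log_of_pos hq
    have hinv : 1 - (1 + ε₀)⁻¹ = ε₀ / (1 + ε₀) := by field_simp; ring
    have h2 : ε₀ / 2 ≤ ε₀ / (1 + ε₀) :=
      div_le_div_of_nonneg_left hε₀.le hq (by linarith)
    linarith
  rw [Real.rpow_def_of_pos hq]
  set y := p * ε₀ / 2 with hy
  have hy0 : 0 ≤ y := by positivity
  have hy1 : y ≤ 1 := by
    rw [hy]; nlinarith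
  have h1 : Real.exp (Real.log (1 + ε₀) * -p) ≤ Real.exp (-y) :=
    Real.exp_le_exp.mpr (by rw [hy]; nlinarith)
  have h2 : Real.exp (-y) ≤ (1 + y)⁻¹ := by
    rw [Real.exp_neg]
    exact inv_anti₀ (by positivity) (by linarith [Real.add_one_le_exp y])
  have h3 : (1 + y)⁻¹ ≤ 1 - y / 2 := by
    rw [inv_le_iff_one_le_mul₀ (by positivity)]
    nlinarith
  calc Real.exp (Real.log (1 + ε₀) * -p) ≤ 1 - y / 2 := h1.trans (h2.trans h3)
    _ = 1 - p * ε₀ / 4 := by rw [hy]; ring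

section Exit

variable {γ ε₀ K ε C₁ C₂ C₃ : ℝ} {n₀ N : ℤ} {τ : ℤ → ℝ} {Xr : Fin 4 → ℤ → ℝ → ℝ} {Er : ℤ → ℝ → ℝ}

/-! ## Lemma 6.9: almost all energy in the primary modes -/

/-- The explicit `O((1+ε₀)^{-n₀/2})` of Lemma 6.9:
`primaryDefect = C₂ (1+ε₀)² (1+ε₀)^{-n₀/2} (cumEnergyConst ε₀ C₃ + 100)`.
[cite: Tao2016AveragedNS, §6.5 Lemma 6.9] -/
def primaryDefect (ε₀ C₂ C₃ : ℝ) (n₀ : ℤ) : ℝ :=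
  C₂ * (1 + ε₀) ^ (2 : ℝ) * (1 + ε₀) ^ (-(n₀ : ℝ) / 2) * (cumEnergyConst ε₀ C₃ + 100)

/-- `primaryDefect ≥ 0`. [cite: Tao2016AveragedNS, §6.5 Lemma 6.9] -/
theorem primaryDefect_nonneg {ε₀ C₂ C₃ : ℝ} {n₀ : ℤ} (hε₀ : 0 < ε₀) (hC₂ : 0 ≤ C₂)
    (hC₃ : 0 ≤ C₃) : 0 ≤ primaryDefect ε₀ C₂ C₃ n₀ := by
  unfold primaryDefect
  have := cumEnergyConst_nonneg hε₀ hC₃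
  have h0 : (0 : ℝ) < 1 + ε₀ := by linarith
  positivity

/-- On `[0, T₁]` the energies `Ẽ_{-1}, Ẽ_0, Ẽ_1` are at most `1` (from `GoodAt`, `K ≥ 2`).
[cite: Tao2016AveragedNS, §6.5 p. 35] -/
theorem RescaledHypotheses.energy_le_one_of_goodAt
    (h : RescaledHypotheses γ ε₀ K ε C₁ C₂ C₃ n₀ N τ Xr Er) (hε₀ : 0 < ε₀) (hε₀1 : ε₀ < 1)
    (hK : 2 ≤ K) (hN : n₀ ≤ N) {t : ℝ} (ht : 0 ≤ t) (hg : GoodAt ε₀ K Xr Er t) {k : ℤ}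
    (hk : k = -1 ∨ k = 0 ∨ k = 1) : Er k t ≤ 1 := by
  have hτ : τ (n₀ - N) ≤ t := (h.tau_init_le hN).trans ht
  have h0 := h.nonneg_F 0 t hτ
  have h1 := h.nonneg_F 1 t hτ
  rcases hk with rfl | rfl | rfl
  · have hb := hg.before 2 le_rfl
    have hidx : (1 : ℤ) - ((2 : ℕ) : ℤ) = -1 := by norm_num
    rw [hidx] at hb
    have hq : (1 + ε₀) ^ ((((2 : ℕ) : ℝ)) / 10) ≤ 2 := by
      calc (1 + ε₀) ^ ((((2 : ℕ) : ℝ)) / 10) ≤ (1 + ε₀) ^ (1 : ℝ) :=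
            Real.rpow_le_rpow_of_exponent_le (by linarith) (by norm_num)
        _ ≤ 2 := by rw [Real.rpow_one]; linarith
    have hK10 : (K ^ 10)⁻¹ ≤ 1 / 2 := by
      rw [one_div]; apply inv_anti₀ (by norm_num)
      exact le_trans (by norm_num) (pow_le_pow_left₀ (by norm_num) hK 10)
    calc Er (-1) t ≤ (K ^ 10)⁻¹ * (1 + ε₀) ^ ((((2 : ℕ) : ℝ)) / 10) := hb
      _ ≤ 1 / 2 * 2 := mul_le_mul hK10 hq (by positivity) (by norm_num)
      _ = 1 := by norm_num
  · linarith [hg.during]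
  · linarith [hg.during]

/-- **Lemma 6.9 (almost all energy in primary modes)**, explicit: for `k ∈ {-1, 0, 1}` and
`t ∈ [0, T₁]` (more precisely: `t ∈ [0, 100]` with `GoodAt` on `[0, t]`),
`0 ≤ Ẽ_k(t) - ½(a_k²+b_k²+c_k²+d_k²)(t) ≤ primaryDefect ε₀ C₂ C₃ n₀`.
[cite: Tao2016AveragedNS, §6.5 Lemma 6.9] -/
theorem RescaledHypotheses.energy_sub_half_sum
    (h : RescaledHypotheses γ ε₀ K ε C₁ C₂ C₃ n₀ N τ Xr Er) (hε₀ : 0 < ε₀) (hε₀1 : ε₀ < 1)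
    (hK : 2 ≤ K) (hC₂ : 0 ≤ C₂) (hC₃ : 0 ≤ C₃) (hN : n₀ ≤ N) {t : ℝ} (ht : t ∈ Icc (0 : ℝ) 100)
    (hg : ∀ s ∈ Icc 0 t, GoodAt ε₀ K Xr Er s) {k : ℤ} (hk : k = -1 ∨ k = 0 ∨ k = 1) :
    0 ≤ Er k t - (1 / 2) * ∑ i, Xr i k t ^ 2 ∧
      Er k t - (1 / 2) * ∑ i, Xr i k t ^ 2 ≤ primaryDefect ε₀ C₂ C₃ n₀ := by
  have hq0 : (0 : ℝ) < 1 + ε₀ := by linarith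
  have hq1 : (1 : ℝ) ≤ 1 + ε₀ := by linarith
  have hK1 : 1 ≤ K := by linarith
  have hτ0 : τ (n₀ - N) ≤ 0 := h.tau_init_le hN
  have hτ : τ (n₀ - N) ≤ t := hτ0.trans ht.1
  refine ⟨by linarith [h.defect_lower k t hτ], ?_⟩
  have hup := h.defect_upper k t hτ
  -- the integral over the past and over `[0, t]`
  have hpast := h.integral_energy_past_le_zero hε₀ hε₀1 hK1 hC₃ hN hk
  have hpresent : ∫ s in (0 : ℝ)..t, Er k s ≤ 100 := by
    have hb : ∀ s ∈ Ι (0 : ℝ) t, ‖Er k s‖ ≤ 1 := by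
      intro s hs
      rw [uIoc_of_le ht.1] at hs
      have hgs := hg s ⟨hs.1.le, hs.2⟩
      rw [Real.norm_eq_abs, abs_of_nonneg (h.nonneg_F k s (hτ0.trans hs.1.le))]
      exact h.energy_le_one_of_goodAt hε₀ hε₀1 hK hN hs.1.le hgs hk
    have := norm_integral_le_of_norm_le_const hb
    rw [Real.norm_eq_abs, sub_zero, abs_of_nonneg ht.1] at this
    have h2 := le_abs_self (∫ s in (0 : ℝ)..t, Er k s)
    nlinarith [ht.2]
  have hint : ∫ s in (τ (n₀ - N))..t, Er k s ≤ cumEnergyConst ε₀ C₃ + 100 := by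
    have hi1 : IntervalIntegrable (Er k) volume (τ (n₀ - N)) 0 :=
      (h.continuousOn_E k le_rfl).intervalIntegrable_of_Icc hτ0
    have hi2 : IntervalIntegrable (Er k) volume 0 t :=
      (h.continuousOn_E k hτ0).intervalIntegrable_of_Icc ht.1
    rw [← integral_add_adjacent_intervals hi1 hi2]
    linarith
  have hcoef : C₂ * (1 + ε₀) ^ ((2 : ℝ) * k - n₀ / 2) ≤
      C₂ * (1 + ε₀) ^ (2 : ℝ) * (1 + ε₀) ^ (-(n₀ : ℝ) / 2) := by
    rw [mul_assoc, ← Real.rpow_add hq0]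
    apply mul_le_mul_of_nonneg_left _ hC₂
    apply Real.rpow_le_rpow_of_exponent_le hq1
    have hk1 : (k : ℝ) ≤ 1 := by rcases hk with rfl | rfl | rfl <;> norm_num
    linarith
  have hint0 : 0 ≤ ∫ s in (τ (n₀ - N))..t, Er k s :=
    integral_nonneg hτ fun s hs => h.nonneg_F k s hs.1
  unfold primaryDefect
  calc Er k t - 1 / 2 * ∑ i, Xr i k t ^ 2
      ≤ C₂ * (1 + ε₀) ^ ((2 : ℝ) * k - n₀ / 2) * ∫ s in (τ (n₀ - N))..t, Er k s := by linarith
    _ ≤ C₂ * (1 + ε₀) ^ (2 : ℝ) * (1 + ε₀) ^ (-(n₀ : ℝ) / 2) * (cumEnergyConst ε₀ C₃ + 100) :=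
        mul_le_mul hcoef hint hint0 (by positivity)

/-! ## Lemma 6.10: closing some exits -/

/-- The integrated energy inequality (6.47) on `[0, T]`:
`Ẽ_k(T) ≤ Ẽ_k(0) + ∫_0^T K (1+ε₀)^{5k/2} (d_{k-1}² a_k - (1+ε₀)^{5/2} d_k² a_{k+1})`
("Integrating (6.47) on `[0, T₁]`", proof of Lemma 6.10). [cite: Tao2016AveragedNS, §6.5 Lemma 6.10] -/
theorem RescaledHypotheses.energy_le_init_add_integral
    (h : RescaledHypotheses γ ε₀ K ε C₁ C₂ C₃ n₀ N τ Xr Er) (hN : n₀ ≤ N) (k : ℤ) {T : ℝ}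
    (hT : 0 ≤ T) :
    Er k T ≤ Er k 0 + ∫ t in (0 : ℝ)..T, K * (1 + ε₀) ^ ((5 : ℝ) * k / 2) *
      (Xr 3 (k - 1) t ^ 2 * Xr 0 k t - (1 + ε₀) ^ ((5 : ℝ) / 2) * Xr 3 k t ^ 2 * Xr 0 (k + 1) t) := by
  have hτ0 : τ (n₀ - N) ≤ 0 := h.tau_init_le hN
  apply le_add_integral_of_deriv_right_le (b := T) (h.continuousOn_E k hτ0)
    (fun t ht => h.hasDeriv_E k (hτ0.trans ht.1))
  · apply ContinuousOn.mul continuousOn_const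
    apply ContinuousOn.sub
    · exact ((h.continuousOn_X 3 (k - 1) hτ0).pow 2).mul (h.continuousOn_X 0 k hτ0)
    · exact ((continuousOn_const.mul ((h.continuousOn_X 3 k hτ0).pow 2)).mul
        (h.continuousOn_X 0 (k + 1) hτ0))
  · intro t ht
    exact h.energy k t (hτ0.trans ht.1)
  · exact ⟨hT, le_rfl⟩

/-- Bounding a time integral over `[0, T] ⊆ [0, 100]` by `100 ·` a pointwise bound.
[folklore] -/
theorem integral_le_hundred_mul {f : ℝ → ℝ} {T B : ℝ} (hT : T ∈ Icc (0 : ℝ) 100) (hB : 0 ≤ B)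
    (hf : ∀ t ∈ Icc 0 T, |f t| ≤ B) : ∫ t in (0 : ℝ)..T, f t ≤ 100 * B := by
  have hb : ∀ s ∈ Ι (0 : ℝ) T, ‖f s‖ ≤ B := fun s hs => by
    rw [uIoc_of_le hT.1] at hs
    exact hf s ⟨hs.1.le, hs.2⟩
  have := norm_integral_le_of_norm_le_const hb
  rw [Real.norm_eq_abs, sub_zero, abs_of_nonneg hT.1] at this
  have h2 := le_abs_self (∫ s in (0 : ℝ)..T, f s)
  nlinarith [hT.2]

/-- Mode bounds inside the regime `GoodAt` (from `Xr_i² ≤ 2Ẽ`), as square bounds: for `j ≥ 2`,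
`Xr_i(1-j)² ≤ 2 K^{-10} (1+ε₀)^{j/10}`; `Xr_i(0)², Xr_i(1)² ≤ 2`; for `j ≥ 1`,
`Xr_i(1+j)² ≤ 2 K^{-30} (1+ε₀)^{-10 j}`. [cite: Tao2016AveragedNS, §6.5 Lemma 6.10] -/
theorem RescaledHypotheses.sq_bounds_of_goodAt
    (h : RescaledHypotheses γ ε₀ K ε C₁ C₂ C₃ n₀ N τ Xr Er) (hN : n₀ ≤ N) {t : ℝ} (ht : 0 ≤ t)
    (hg : GoodAt ε₀ K Xr Er t) (i : Fin 4) :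
    (∀ j : ℕ, 2 ≤ j → Xr i (1 - j) t ^ 2 ≤ 2 * ((K ^ 10)⁻¹ * (1 + ε₀) ^ ((j : ℝ) / 10))) ∧
      Xr i 0 t ^ 2 ≤ 2 ∧ Xr i 1 t ^ 2 ≤ 2 ∧
      (∀ j : ℕ, 1 ≤ j → Xr i (1 + j) t ^ 2 ≤ 2 * ((K ^ 30)⁻¹ * (1 + ε₀) ^ (-(10 : ℝ) * j))) := by
  have hτ : τ (n₀ - N) ≤ t := (h.tau_init_le hN).trans ht
  have hE0 := h.nonneg_F 0 t hτ
  have hE1 := h.nonneg_F 1 t hτ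
  refine ⟨fun j hj => ?_, ?_, ?_, fun j hj => ?_⟩
  · exact (h.sq_le_two_mul_energy i _ hτ).trans (by linarith [hg.before j hj])
  · exact (h.sq_le_two_mul_energy i _ hτ).trans (by linarith [hg.during])
  · exact (h.sq_le_two_mul_energy i _ hτ).trans (by linarith [hg.during])
  · exact (h.sq_le_two_mul_energy i _ hτ).trans (by linarith [hg.after j hj])

/-- `|x² y| ≤ α β` from `x² ≤ α`, `|y| ≤ β`. [folklore] -/
theorem abs_sq_mul_le {x y α β : ℝ} (hx : x ^ 2 ≤ α) (hy : |y| ≤ β) : |x ^ 2 * y| ≤ α * β := by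
  rw [abs_mul, abs_of_nonneg (sq_nonneg x)]
  exact mul_le_mul hx hy (abs_nonneg _) ((sq_nonneg x).trans hx)

/-- From `10⁸ ≤ ε₀ K⁴` and `ε₀ < 1`: `K ≥ 100`. [folklore] -/
theorem hundred_le_of_regime {ε₀ K : ℝ} (hε₀1 : ε₀ < 1) (hK : 0 < K)
    (hKε : 10 ^ 8 ≤ ε₀ * K ^ 4) : 100 ≤ K := by
  by_contra hcon
  push Not at hcon
  have h4 : K ^ 4 < 100 ^ 4 := pow_lt_pow_left₀ hcon hK.le (by norm_num)
  have : ε₀ * K ^ 4 ≤ K ^ 4 := by nlinarith [pow_pos hK 4]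
  linarith

/-- **Lemma 6.10, (6.91) "near exit"**: `Ẽ_0(T) + Ẽ_1(T) < 1` at every `T ∈ [0, 100]` up to which
`GoodAt` holds (the flux `d_{-1}² a_0 - (1+ε₀)^5 d_1² a_2` is `O(K^{-9})`, integrated over a
time `≤ 100`, on top of `Ẽ_0(0)+Ẽ_1(0) ≤ 0.6`). Largeness used: `10⁸ ≤ ε₀ K⁴`.
[cite: Tao2016AveragedNS, §6.5 Lemma 6.10] -/
theorem RescaledHypotheses.exit_near
    (h : RescaledHypotheses γ ε₀ K ε C₁ C₂ C₃ n₀ N τ Xr Er) (hε₀ : 0 < ε₀) (hε₀1 : ε₀ < 1)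
    (hγ1 : γ ≤ 1 / 10 ^ 5) (hK : 0 < K) (hKε : 10 ^ 8 ≤ ε₀ * K ^ 4) (hε : 0 < ε) (hε1 : ε ≤ 1)
    (hC₂ : 0 ≤ C₂) (hC₃ : 0 ≤ C₃) (hN : n₀ ≤ N)
    (hn : C₂ * (1 + ε₀) ^ (-(n₀ : ℝ) / 2) * cumEnergyConst ε₀ C₃ ≤ 1 / 100)
    {T : ℝ} (hT : T ∈ Icc (0 : ℝ) 100) (hg : ∀ t ∈ Icc 0 T, GoodAt ε₀ K Xr Er t) :
    Er 0 T + Er 1 T < 1 := by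
  have hq0 : (0 : ℝ) < 1 + ε₀ := by linarith
  have hq1 : (1 : ℝ) ≤ 1 + ε₀ := by linarith
  have hq2 : (1 + ε₀ : ℝ) ≤ 2 := by linarith
  have hK100 := hundred_le_of_regime hε₀1 hK hKε
  have hK10 : (10 : ℝ) ≤ K := by linarith
  have hK2 : (2 : ℝ) ≤ K := by linarith
  have hτ0 : τ (n₀ - N) ≤ 0 := h.tau_init_le hN
  have h0 := h.energy_le_init_add_integral hN 0 hT.1
  have h1 := h.energy_le_init_add_integral hN 1 hT.1
  have hinit := h.energy_zero_during hε₀ hε₀1 hγ1 hK2 hε hε1 hC₂ hC₃ hN hn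
  -- the two fluxes
  set A0 : ℝ → ℝ := fun t => K * (1 + ε₀) ^ ((5 : ℝ) * ((0 : ℤ) : ℝ) / 2) *
    (Xr 3 (0 - 1) t ^ 2 * Xr 0 0 t - (1 + ε₀) ^ ((5 : ℝ) / 2) * Xr 3 0 t ^ 2 * Xr 0 (0 + 1) t)
    with hA0
  set A1 : ℝ → ℝ := fun t => K * (1 + ε₀) ^ ((5 : ℝ) * ((1 : ℤ) : ℝ) / 2) *
    (Xr 3 (1 - 1) t ^ 2 * Xr 0 1 t - (1 + ε₀) ^ ((5 : ℝ) / 2) * Xr 3 1 t ^ 2 * Xr 0 (1 + 1) t)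
    with hA1
  have hcont : ∀ (i : Fin 4) (k : ℤ), ContinuousOn (Xr i k) (Icc 0 T) := fun i k =>
    h.continuousOn_X i k hτ0
  have hA0c : ContinuousOn A0 (Icc 0 T) := by
    apply ContinuousOn.mul continuousOn_const
    exact (((hcont 3 (0 - 1)).pow 2).mul (hcont 0 0)).sub
      ((continuousOn_const.mul ((hcont 3 0).pow 2)).mul (hcont 0 (0 + 1)))
  have hA1c : ContinuousOn A1 (Icc 0 T) := by
    apply ContinuousOn.mul continuousOn_const
    exact (((hcont 3 (1 - 1)).pow 2).mul (hcont 0 1)).sub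
      ((continuousOn_const.mul ((hcont 3 1).pow 2)).mul (hcont 0 (1 + 1)))
  have hsum : (∫ t in (0 : ℝ)..T, A0 t) + (∫ t in (0 : ℝ)..T, A1 t) =
      ∫ t in (0 : ℝ)..T, (A0 t + A1 t) :=
    (intervalIntegral.integral_add (hA0c.intervalIntegrable_of_Icc hT.1)
      (hA1c.intervalIntegrable_of_Icc hT.1)).symm
  -- pointwise the sum is `K (d_{-1}² a_0 - q^5 d_1² a_2)`
  have hq5 : (1 + ε₀) ^ ((5 : ℝ) / 2) * (1 + ε₀) ^ ((5 : ℝ) / 2) = (1 + ε₀) ^ (5 : ℝ) := by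
    rw [← Real.rpow_add hq0]; norm_num
  have hpt : ∀ t, A0 t + A1 t =
      K * (Xr 3 (-1) t ^ 2 * Xr 0 0 t - (1 + ε₀) ^ (5 : ℝ) * Xr 3 1 t ^ 2 * Xr 0 2 t) := by
    intro t
    simp only [hA0, hA1]
    have e1 : (1 + ε₀) ^ ((5 : ℝ) * ((0 : ℤ) : ℝ) / 2) = 1 := by norm_num
    have e2 : (1 + ε₀) ^ ((5 : ℝ) * ((1 : ℤ) : ℝ) / 2) = (1 + ε₀) ^ ((5 : ℝ) / 2) := by norm_num
    rw [e1, e2, ← hq5]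
    norm_num
    ring
  -- pointwise bound `|A0 + A1| ≤ 7 K^{-9}`
  have hbound : ∀ t ∈ Icc 0 T, |A0 t + A1 t| ≤ 7 * (K ^ 9)⁻¹ := by
    intro t ht
    have hgt := hg t ht
    obtain ⟨hb3, -, -, -⟩ := h.sq_bounds_of_goodAt hN ht.1 hgt 3
    obtain ⟨-, ha0, -, hpost0⟩ := h.sq_bounds_of_goodAt hN ht.1 hgt 0
    have hd1 : Xr 3 1 t ^ 2 ≤ 1 / 4 * (K ^ 20)⁻¹ := by
      have := hgt.d_le
      have h2 : Xr 3 1 t ^ 2 = |Xr 3 1 t| ^ 2 := (sq_abs _).symm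
      rw [h2]
      calc |Xr 3 1 t| ^ 2 ≤ (1 / 2 * (K ^ 10)⁻¹) ^ 2 := pow_le_pow_left₀ (abs_nonneg _) this 2
        _ = 1 / 4 * (K ^ 20)⁻¹ := by rw [mul_pow, inv_pow, ← pow_mul]; norm_num
    -- `d_{-1}² ≤ 4 K^{-10}`
    have hdm1 : Xr 3 (-1) t ^ 2 ≤ 4 * (K ^ 10)⁻¹ := by
      have := hb3 2 le_rfl
      have hidx : (1 : ℤ) - ((2 : ℕ) : ℤ) = -1 := by norm_num
      rw [hidx] at this
      have hq : (1 + ε₀) ^ ((((2 : ℕ) : ℝ)) / 10) ≤ 2 :=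
        (Real.rpow_le_rpow_of_exponent_le hq1 (by norm_num : (((2 : ℕ) : ℝ)) / 10 ≤ 1)).trans
          (by rw [Real.rpow_one]; linarith)
      have hK10i : 0 ≤ (K ^ 10)⁻¹ := by positivity
      nlinarith
    -- `|a_0| ≤ 3/2`, `|a_2| ≤ 2 K^{-15}`
    have ha0' : |Xr 0 0 t| ≤ 3 / 2 := abs_le_of_sq_le_sq (by linarith) (by norm_num)
    have ha2' : |Xr 0 2 t| ≤ 2 * (K ^ 15)⁻¹ := by
      have := hpost0 1 le_rfl
      have hidx : (1 : ℤ) + ((1 : ℕ) : ℤ) = 2 := by norm_num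
      rw [hidx] at this
      apply abs_le_of_sq_le_sq _ (by positivity)
      have hq : (1 + ε₀) ^ (-(10 : ℝ) * ((1 : ℕ) : ℝ)) ≤ 1 :=
        Real.rpow_le_one_of_one_le_of_nonpos hq1 (by norm_num)
      have hK30 : 0 ≤ (K ^ 30)⁻¹ := by positivity
      calc Xr 0 2 t ^ 2 ≤ 2 * ((K ^ 30)⁻¹ * (1 + ε₀) ^ (-(10 : ℝ) * ((1 : ℕ) : ℝ))) := this
        _ ≤ 2 * ((K ^ 30)⁻¹ * 1) := by gcongr
        _ ≤ (2 * (K ^ 15)⁻¹) ^ 2 := by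
            rw [mul_pow, inv_pow, ← pow_mul]; norm_num
            nlinarith
    have hq5le : (1 + ε₀) ^ (5 : ℝ) ≤ 32 := by
      calc (1 + ε₀) ^ (5 : ℝ) ≤ (2 : ℝ) ^ (5 : ℝ) := Real.rpow_le_rpow hq0.le hq2 (by norm_num)
        _ = 32 := by norm_num
    have t1 := abs_sq_mul_le hdm1 ha0'
    have t2 := abs_sq_mul_le hd1 ha2'
    rw [hpt t, abs_mul, abs_of_pos hK]
    have htri : |Xr 3 (-1) t ^ 2 * Xr 0 0 t - (1 + ε₀) ^ (5 : ℝ) * Xr 3 1 t ^ 2 * Xr 0 2 t| ≤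
        4 * (K ^ 10)⁻¹ * (3 / 2) + 32 * (1 / 4 * (K ^ 20)⁻¹ * (2 * (K ^ 15)⁻¹)) := by
      have e : (1 + ε₀) ^ (5 : ℝ) * Xr 3 1 t ^ 2 * Xr 0 2 t =
          (1 + ε₀) ^ (5 : ℝ) * (Xr 3 1 t ^ 2 * Xr 0 2 t) := by ring
      rw [e]
      refine (abs_sub _ _).trans (add_le_add t1 ?_)
      rw [abs_mul, abs_of_pos (Real.rpow_pos_of_pos hq0 _)]
      exact mul_le_mul hq5le t2 (abs_nonneg _) (by norm_num)
    -- `K (6 K^{-10} + 16 K^{-35}) ≤ 7 K^{-9}`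
    have hK9 : K * (4 * (K ^ 10)⁻¹ * (3 / 2) + 32 * (1 / 4 * (K ^ 20)⁻¹ * (2 * (K ^ 15)⁻¹))) ≤
        7 * (K ^ 9)⁻¹ := by
      have hK25 : (16 : ℝ) ≤ K ^ 25 := le_trans (by norm_num) (pow_le_pow_left₀ (by norm_num) hK2 25)
      field_simp
      nlinarith [pow_pos hK 9, pow_pos hK 25]
    calc K * |Xr 3 (-1) t ^ 2 * Xr 0 0 t - (1 + ε₀) ^ (5 : ℝ) * Xr 3 1 t ^ 2 * Xr 0 2 t|
        ≤ K * (4 * (K ^ 10)⁻¹ * (3 / 2) + 32 * (1 / 4 * (K ^ 20)⁻¹ * (2 * (K ^ 15)⁻¹))) :=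
          mul_le_mul_of_nonneg_left htri hK.le
      _ ≤ 7 * (K ^ 9)⁻¹ := hK9
  have hint := integral_le_hundred_mul hT (by positivity) hbound
  -- conclude: `0.6 + 700 K^{-9} < 1`
  have hK9 : 700 * (K ^ 9)⁻¹ < 2 / 5 := by
    rw [← div_eq_mul_inv, div_lt_iff₀ (by positivity)]
    have : (10 : ℝ) ^ 9 ≤ K ^ 9 := pow_le_pow_left₀ (by norm_num) hK10 9
    nlinarith
  have hA0i : Er 0 T ≤ Er 0 0 + ∫ t in (0 : ℝ)..T, A0 t := h0
  have hA1i : Er 1 T ≤ Er 1 0 + ∫ t in (0 : ℝ)..T, A1 t := h1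
  linarith [hsum]

/-- `q^a q^b q^c ≤ 1` for `q ≥ 1` and `a + b + c ≤ 0`. [folklore] -/
theorem rpow3_le_one {q a b c : ℝ} (hq : 1 ≤ q) (h : a + b + c ≤ 0) : q ^ a * q ^ b * q ^ c ≤ 1 := by
  have hq0 : 0 < q := by linarith
  rw [← Real.rpow_add hq0, ← Real.rpow_add hq0]
  exact Real.rpow_le_one_of_one_le_of_nonpos hq h

/-- `q^a q^b q^c ≤ q^d` for `q ≥ 1` and `a + b + c ≤ d`. [folklore] -/
theorem rpow3_le_rpow {q a b c d : ℝ} (hq : 1 ≤ q) (h : a + b + c ≤ d) :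
    q ^ a * q ^ b * q ^ c ≤ q ^ d := by
  have hq0 : 0 < q := by linarith
  rw [← Real.rpow_add hq0, ← Real.rpow_add hq0]
  exact Real.rpow_le_rpow_of_exponent_le hq h

/-- `q^a q^b q^c q^d ≤ q^e` for `q ≥ 1` and `a + b + c + d ≤ e`. [folklore] -/
theorem rpow4_le_rpow {q a b c d e : ℝ} (hq : 1 ≤ q) (h : a + b + c + d ≤ e) :
    q ^ a * q ^ b * q ^ c * q ^ d ≤ q ^ e := by
  have hq0 : 0 < q := by linarith
  rw [← Real.rpow_add hq0, ← Real.rpow_add hq0, ← Real.rpow_add hq0]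
  exact Real.rpow_le_rpow_of_exponent_le hq h

/-- The flux `A_k(t) = K (1+ε₀)^{5k/2} (d_{k-1}² a_k - (1+ε₀)^{5/2} d_k² a_{k+1})` of the energy
inequality (6.47). [cite: Tao2016AveragedNS, §6.4 Prop. 6.5 (ii)] -/
def flux (ε₀ K : ℝ) (Xr : Fin 4 → ℤ → ℝ → ℝ) (k : ℤ) (t : ℝ) : ℝ :=
  K * (1 + ε₀) ^ ((5 : ℝ) * k / 2) *
    (Xr 3 (k - 1) t ^ 2 * Xr 0 k t - (1 + ε₀) ^ ((5 : ℝ) / 2) * Xr 3 k t ^ 2 * Xr 0 (k + 1) t)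

/-- Bounding the flux from bounds on its four factors: if `d_{k-1}² ≤ α`, `|a_k| ≤ β`, `d_k² ≤ γ`,
`|a_{k+1}| ≤ δ`, then `|A_k| ≤ K (q^{5k/2} α β + q^{5k/2} q^{5/2} γ δ)`.
[cite: Tao2016AveragedNS, §6.5 Lemma 6.10] -/
theorem abs_flux_le {ε₀ K : ℝ} {Xr : Fin 4 → ℤ → ℝ → ℝ} {k : ℤ} {t : ℝ} (hε₀ : 0 < ε₀)
    (hK : 0 < K) {α β γ δ : ℝ} (h1 : Xr 3 (k - 1) t ^ 2 ≤ α) (h2 : |Xr 0 k t| ≤ β)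
    (h3 : Xr 3 k t ^ 2 ≤ γ) (h4 : |Xr 0 (k + 1) t| ≤ δ) :
    |flux ε₀ K Xr k t| ≤ K * ((1 + ε₀) ^ ((5 : ℝ) * k / 2) * (α * β) +
      (1 + ε₀) ^ ((5 : ℝ) * k / 2) * (1 + ε₀) ^ ((5 : ℝ) / 2) * (γ * δ)) := by
  have hq0 : (0 : ℝ) < 1 + ε₀ := by linarith
  have hP : 0 < (1 + ε₀) ^ ((5 : ℝ) * k / 2) := Real.rpow_pos_of_pos hq0 _
  have hP5 : 0 < (1 + ε₀) ^ ((5 : ℝ) / 2) := Real.rpow_pos_of_pos hq0 _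
  have t1 := abs_sq_mul_le h1 h2
  have t2 := abs_sq_mul_le h3 h4
  unfold flux
  rw [abs_mul, abs_mul, abs_of_pos hK, abs_of_pos hP]
  have e : (1 + ε₀) ^ ((5 : ℝ) / 2) * Xr 3 k t ^ 2 * Xr 0 (k + 1) t =
      (1 + ε₀) ^ ((5 : ℝ) / 2) * (Xr 3 k t ^ 2 * Xr 0 (k + 1) t) := by ring
  rw [e]
  have htri : |Xr 3 (k - 1) t ^ 2 * Xr 0 k t - (1 + ε₀) ^ ((5 : ℝ) / 2) *
      (Xr 3 k t ^ 2 * Xr 0 (k + 1) t)| ≤ α * β + (1 + ε₀) ^ ((5 : ℝ) / 2) * (γ * δ) := by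
    refine (abs_sub _ _).trans (add_le_add t1 ?_)
    rw [abs_mul, abs_of_pos hP5]
    exact mul_le_mul_of_nonneg_left t2 hP5.le
  calc K * (1 + ε₀) ^ ((5 : ℝ) * k / 2) * |Xr 3 (k - 1) t ^ 2 * Xr 0 k t -
        (1 + ε₀) ^ ((5 : ℝ) / 2) * (Xr 3 k t ^ 2 * Xr 0 (k + 1) t)|
      ≤ K * (1 + ε₀) ^ ((5 : ℝ) * k / 2) * (α * β + (1 + ε₀) ^ ((5 : ℝ) / 2) * (γ * δ)) :=
        mul_le_mul_of_nonneg_left htri (by positivity)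
    _ = _ := by ring

/-- **Lemma 6.10, (6.89) "far exit"**: `Ẽ_{1-m}(T) < K^{-10}(1+ε₀)^{m/10}` for `m ≥ 3`, at every
`T ∈ [0, 100]` up to which `GoodAt` holds. Largeness used: `10⁸ ≤ ε₀ K⁴` (to absorb the factor
`(1+ε₀)^{-0.08}` of Lemma 6.8 against the `O(K^{-14})` flux). [cite: Tao2016AveragedNS, §6.5 Lemma 6.10] -/
theorem RescaledHypotheses.exit_far
    (h : RescaledHypotheses γ ε₀ K ε C₁ C₂ C₃ n₀ N τ Xr Er) (hε₀ : 0 < ε₀) (hε₀1 : ε₀ < 1)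
    (hK : 0 < K) (hKε : 10 ^ 8 ≤ ε₀ * K ^ 4) (hN : n₀ ≤ N)
    {T : ℝ} (hT : T ∈ Icc (0 : ℝ) 100) (hg : ∀ t ∈ Icc 0 T, GoodAt ε₀ K Xr Er t)
    (m : ℕ) (hm : 3 ≤ m) :
    Er (1 - m) T < (K ^ 10)⁻¹ * (1 + ε₀) ^ ((m : ℝ) / 10) := by
  have hq0 : (0 : ℝ) < 1 + ε₀ := by linarith
  have hq1 : (1 : ℝ) ≤ 1 + ε₀ := by linarith
  have hK100 := hundred_le_of_regime hε₀1 hK hKε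
  have hK1 : (1 : ℝ) ≤ K := by linarith
  have hτ0 : τ (n₀ - N) ≤ 0 := h.tau_init_le hN
  set k : ℤ := 1 - m with hk
  have hinit := h.energy_zero_before hε₀ hK1 hN m (by omega)
  have hineq := h.energy_le_init_add_integral hN k hT.1
  -- pointwise flux bound `|A_k| ≤ 8 K^{-14}`
  have hbound : ∀ t ∈ Icc 0 T, |flux ε₀ K Xr k t| ≤ 8 * (K ^ 14)⁻¹ := by
    intro t ht
    have hgt := hg t ht
    obtain ⟨hb3, -, -, -⟩ := h.sq_bounds_of_goodAt hN ht.1 hgt 3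
    obtain ⟨hb0, -, -, -⟩ := h.sq_bounds_of_goodAt hN ht.1 hgt 0
    -- the four factor bounds
    have h1 : Xr 3 (k - 1) t ^ 2 ≤ 2 * ((K ^ 10)⁻¹ * (1 + ε₀) ^ (((m + 1 : ℕ) : ℝ) / 10)) := by
      have := hb3 (m + 1) (by omega)
      have hidx : (1 : ℤ) - ((m + 1 : ℕ) : ℤ) = k - 1 := by rw [hk]; push_cast; ring
      rwa [hidx] at this
    have h2 : |Xr 0 k t| ≤ 2 * (K ^ 5)⁻¹ * (1 + ε₀) ^ ((m : ℝ) / 20) := by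
      have := hb0 m (by omega)
      apply abs_le_of_sq_le_sq _ (by positivity)
      calc Xr 0 k t ^ 2 = Xr 0 (1 - m) t ^ 2 := by rw [hk]
        _ ≤ 2 * ((K ^ 10)⁻¹ * (1 + ε₀) ^ ((m : ℝ) / 10)) := this
        _ ≤ (2 * (K ^ 5)⁻¹ * (1 + ε₀) ^ ((m : ℝ) / 20)) ^ 2 := by
            have hsq : ((1 + ε₀) ^ ((m : ℝ) / 20)) ^ 2 = (1 + ε₀) ^ ((m : ℝ) / 10) := by
              rw [sq, ← Real.rpow_add hq0]; congr 1; ring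
            rw [mul_pow, mul_pow, hsq, inv_pow, ← pow_mul]
            have : 0 ≤ (K ^ 10)⁻¹ * (1 + ε₀) ^ ((m : ℝ) / 10) := by positivity
            norm_num; nlinarith
    have h3 : Xr 3 k t ^ 2 ≤ 2 * ((K ^ 10)⁻¹ * (1 + ε₀) ^ ((m : ℝ) / 10)) := by
      have := hb3 m (by omega); rwa [← hk] at this
    have h4 : |Xr 0 (k + 1) t| ≤ 2 * (K ^ 5)⁻¹ * (1 + ε₀) ^ (((m - 1 : ℕ) : ℝ) / 20) := by
      have := hb0 (m - 1) (by omega)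
      have hidx : (1 : ℤ) - ((m - 1 : ℕ) : ℤ) = k + 1 := by
        rw [hk, Nat.cast_sub (by omega)]; push_cast; ring
      rw [hidx] at this
      apply abs_le_of_sq_le_sq _ (by positivity)
      calc Xr 0 (k + 1) t ^ 2 ≤ 2 * ((K ^ 10)⁻¹ * (1 + ε₀) ^ (((m - 1 : ℕ) : ℝ) / 10)) := this
        _ ≤ (2 * (K ^ 5)⁻¹ * (1 + ε₀) ^ (((m - 1 : ℕ) : ℝ) / 20)) ^ 2 := by
            have hsq : ((1 + ε₀) ^ (((m - 1 : ℕ) : ℝ) / 20)) ^ 2 =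
                (1 + ε₀) ^ (((m - 1 : ℕ) : ℝ) / 10) := by
              rw [sq, ← Real.rpow_add hq0]; congr 1; ring
            rw [mul_pow, mul_pow, hsq, inv_pow, ← pow_mul]
            have : 0 ≤ (K ^ 10)⁻¹ * (1 + ε₀) ^ (((m - 1 : ℕ) : ℝ) / 10) := by positivity
            norm_num; nlinarith
    have hA := abs_flux_le hε₀ hK h1 h2 h3 h4
    refine hA.trans ?_
    -- exponent bookkeeping: both products of powers of `q` are `≤ 1` for `m ≥ 3`
    have hm3 : (3 : ℝ) ≤ m := by exact_mod_cast hm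
    have hkR : (k : ℝ) = 1 - m := by rw [hk]; push_cast; ring
    have hm1R : ((m - 1 : ℕ) : ℝ) = m - 1 := by rw [Nat.cast_sub (by omega)]; push_cast; ring
    have hmp1R : ((m + 1 : ℕ) : ℝ) = m + 1 := by push_cast; ring
    have e1 : (1 + ε₀) ^ ((5 : ℝ) * k / 2) * (1 + ε₀) ^ (((m + 1 : ℕ) : ℝ) / 10) *
        (1 + ε₀) ^ ((m : ℝ) / 20) ≤ 1 :=
      rpow3_le_one hq1 (by rw [hkR, hmp1R]; nlinarith)
    have e2 : (1 + ε₀) ^ ((5 : ℝ) * k / 2) * (1 + ε₀) ^ ((5 : ℝ) / 2) *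
        (1 + ε₀) ^ ((m : ℝ) / 10) * (1 + ε₀) ^ (((m - 1 : ℕ) : ℝ) / 20) ≤ 1 := by
      have := rpow4_le_rpow hq1 (q := 1 + ε₀) (a := (5 : ℝ) * k / 2) (b := (5 : ℝ) / 2)
        (c := (m : ℝ) / 10) (d := ((m - 1 : ℕ) : ℝ) / 20) (e := 0) (by rw [hkR, hm1R]; nlinarith)
      simpa using this
    have hK5 : 0 < (K ^ 5)⁻¹ := by positivity
    have hK10 : 0 < (K ^ 10)⁻¹ := by positivity
    have hP1 : 0 ≤ (1 + ε₀) ^ ((5 : ℝ) * k / 2) := (Real.rpow_pos_of_pos hq0 _).le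
    -- reorganise the bound into `K · K^{-15} · (4 e1 + 4 e2)`
    have hre : K * ((1 + ε₀) ^ ((5 : ℝ) * k / 2) *
        (2 * ((K ^ 10)⁻¹ * (1 + ε₀) ^ (((m + 1 : ℕ) : ℝ) / 10)) *
          (2 * (K ^ 5)⁻¹ * (1 + ε₀) ^ ((m : ℝ) / 20))) +
        (1 + ε₀) ^ ((5 : ℝ) * k / 2) * (1 + ε₀) ^ ((5 : ℝ) / 2) *
          (2 * ((K ^ 10)⁻¹ * (1 + ε₀) ^ ((m : ℝ) / 10)) *
            (2 * (K ^ 5)⁻¹ * (1 + ε₀) ^ (((m - 1 : ℕ) : ℝ) / 20)))) =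
        4 * (K * ((K ^ 10)⁻¹ * (K ^ 5)⁻¹)) *
          ((1 + ε₀) ^ ((5 : ℝ) * k / 2) * (1 + ε₀) ^ (((m + 1 : ℕ) : ℝ) / 10) *
            (1 + ε₀) ^ ((m : ℝ) / 20) +
          (1 + ε₀) ^ ((5 : ℝ) * k / 2) * (1 + ε₀) ^ ((5 : ℝ) / 2) *
            (1 + ε₀) ^ ((m : ℝ) / 10) * (1 + ε₀) ^ (((m - 1 : ℕ) : ℝ) / 20)) := by ring
    rw [hre]
    have hKK : K * ((K ^ 10)⁻¹ * (K ^ 5)⁻¹) = (K ^ 14)⁻¹ := by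
      field_simp
    rw [hKK]
    have : 0 < (K ^ 14)⁻¹ := by positivity
    nlinarith
  -- integrate and compare
  have hint := integral_le_hundred_mul hT (by positivity) hbound
  have hnum : (1 + ε₀) ^ (-(2 : ℝ) / 25) ≤ 1 - (2 : ℝ) / 25 * ε₀ / 4 := by
    have := rpow_neg_le_one_sub hε₀ hε₀1.le (p := (2 : ℝ) / 25) (by norm_num) (by norm_num)
    convert this using 2; ring
  have hqm : (1 : ℝ) ≤ (1 + ε₀) ^ ((m : ℝ) / 10) := Real.one_le_rpow hq1 (by positivity)
  have hK10pos : 0 < (K ^ 10)⁻¹ := by positivity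
  -- `800 K^{-14} < (ε₀/50) K^{-10}` from `10⁸ ≤ ε₀ K⁴`
  have hkey : 800 * (K ^ 14)⁻¹ < ε₀ / 50 * (K ^ 10)⁻¹ := by
    have h14 : (K ^ 14)⁻¹ = (K ^ 4)⁻¹ * (K ^ 10)⁻¹ := by rw [← mul_inv, ← pow_add]
    have h4 : 800 * (K ^ 4)⁻¹ < ε₀ / 50 := by
      rw [← div_eq_mul_inv, div_lt_iff₀ (by positivity)]
      nlinarith
    calc 800 * (K ^ 14)⁻¹ = (800 * (K ^ 4)⁻¹) * (K ^ 10)⁻¹ := by rw [h14]; ring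
      _ < ε₀ / 50 * (K ^ 10)⁻¹ := mul_lt_mul_of_pos_right h4 hK10pos
  have hflux : Er k T ≤ Er k 0 + ∫ t in (0 : ℝ)..T, flux ε₀ K Xr k t := hineq
  have hEk0 : Er k 0 ≤ (1 - (2 : ℝ) / 25 * ε₀ / 4) * ((K ^ 10)⁻¹ * (1 + ε₀) ^ ((m : ℝ) / 10)) := by
    rw [hk]
    exact hinit.trans (mul_le_mul_of_nonneg_right hnum (by positivity))
  have hlast : ε₀ / 50 * (K ^ 10)⁻¹ ≤ ε₀ / 50 * ((K ^ 10)⁻¹ * (1 + ε₀) ^ ((m : ℝ) / 10)) := by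
    apply mul_le_mul_of_nonneg_left _ (by positivity)
    nlinarith [hqm, hK10pos]
  linarith [hflux, hEk0, hint, hkey, hlast]

/-- **Lemma 6.10, (6.90) "second far exit"**: `Ẽ_{1+m}(T) < K^{-30}(1+ε₀)^{-10m}` for `m ≥ 1`,
at every `T ∈ [0, 100]` up to which `GoodAt` holds. Largeness used: `10⁸ ≤ ε₀ K⁴`.
[cite: Tao2016AveragedNS, §6.5 Lemma 6.10] -/
theorem RescaledHypotheses.exit_far2
    (h : RescaledHypotheses γ ε₀ K ε C₁ C₂ C₃ n₀ N τ Xr Er) (hε₀ : 0 < ε₀) (hε₀1 : ε₀ < 1)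
    (hK : 0 < K) (hKε : 10 ^ 8 ≤ ε₀ * K ^ 4) (hN : n₀ ≤ N)
    {T : ℝ} (hT : T ∈ Icc (0 : ℝ) 100) (hg : ∀ t ∈ Icc 0 T, GoodAt ε₀ K Xr Er t)
    (m : ℕ) (hm : 1 ≤ m) :
    Er (1 + m) T < (K ^ 30)⁻¹ * (1 + ε₀) ^ (-(10 : ℝ) * m) := by
  have hq0 : (0 : ℝ) < 1 + ε₀ := by linarith
  have hq1 : (1 : ℝ) ≤ 1 + ε₀ := by linarith
  have hq2 : (1 + ε₀ : ℝ) ≤ 2 := by linarith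
  have hK100 := hundred_le_of_regime hε₀1 hK hKε
  have hK1 : (1 : ℝ) ≤ K := by linarith
  have hτ0 : τ (n₀ - N) ≤ 0 := h.tau_init_le hN
  set k : ℤ := 1 + m with hk
  have hinit := h.energy_zero_after hε₀ hK hN m hm
  have hineq := h.energy_le_init_add_integral hN k hT.1
  have hmR : (1 : ℝ) ≤ m := by exact_mod_cast hm
  have hkR : (k : ℝ) = 1 + m := by rw [hk]; push_cast; ring
  -- pointwise flux bound `|A_k| ≤ 33000 K^{-34} q^{-10 m}`
  have hbound : ∀ t ∈ Icc 0 T, |flux ε₀ K Xr k t| ≤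
      33000 * (K ^ 34)⁻¹ * (1 + ε₀) ^ (-(10 : ℝ) * m) := by
    intro t ht
    have hgt := hg t ht
    obtain ⟨-, -, -, hp3⟩ := h.sq_bounds_of_goodAt hN ht.1 hgt 3
    obtain ⟨-, -, -, hp0⟩ := h.sq_bounds_of_goodAt hN ht.1 hgt 0
    -- `d_m² ≤ 2 K^{-20} q^{-10(m-1)}` (from `|d_1| ≤ ½K^{-10}` if `m = 1`)
    have h1 : Xr 3 (k - 1) t ^ 2 ≤ 2 * (K ^ 20)⁻¹ * (1 + ε₀) ^ (-(10 : ℝ) * ((m - 1 : ℕ) : ℝ)) := by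
      have hidx : k - 1 = (m : ℤ) := by rw [hk]; ring
      rw [hidx]
      rcases Nat.lt_or_ge m 2 with hm2 | hm2
      · obtain rfl : m = 1 := by omega
        have hd := hgt.d_le
        have h2 : Xr 3 1 t ^ 2 = |Xr 3 1 t| ^ 2 := (sq_abs _).symm
        simp only [Nat.cast_one, Nat.sub_self, CharP.cast_eq_zero, mul_zero, Real.rpow_zero,
          mul_one]
        rw [h2]
        calc |Xr 3 1 t| ^ 2 ≤ (1 / 2 * (K ^ 10)⁻¹) ^ 2 := pow_le_pow_left₀ (abs_nonneg _) hd 2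
          _ = 1 / 4 * (K ^ 20)⁻¹ := by rw [mul_pow, inv_pow, ← pow_mul]; norm_num
          _ ≤ 2 * (K ^ 20)⁻¹ := by
              have : 0 ≤ (K ^ 20)⁻¹ := by positivity
              nlinarith
      · have := hp3 (m - 1) (by omega)
        have hidx' : (1 : ℤ) + ((m - 1 : ℕ) : ℤ) = m := by
          rw [Nat.cast_sub (by omega)]; push_cast; ring
        rw [hidx'] at this
        have hK30 : (K ^ 30)⁻¹ ≤ (K ^ 20)⁻¹ :=
          inv_anti₀ (by positivity) (pow_le_pow_right₀ hK1 (by norm_num))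
        have hP : 0 ≤ (1 + ε₀) ^ (-(10 : ℝ) * ((m - 1 : ℕ) : ℝ)) := (Real.rpow_pos_of_pos hq0 _).le
        calc Xr 3 (m : ℤ) t ^ 2 ≤ 2 * ((K ^ 30)⁻¹ * (1 + ε₀) ^ (-(10 : ℝ) * ((m - 1 : ℕ) : ℝ))) := this
          _ ≤ 2 * ((K ^ 20)⁻¹ * (1 + ε₀) ^ (-(10 : ℝ) * ((m - 1 : ℕ) : ℝ))) := by gcongr
          _ = _ := by ring
    have hsqrt : ∀ {x : ℝ} {j : ℕ}, x ^ 2 ≤ 2 * ((K ^ 30)⁻¹ * (1 + ε₀) ^ (-(10 : ℝ) * j)) →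
        |x| ≤ 2 * (K ^ 15)⁻¹ * (1 + ε₀) ^ (-(5 : ℝ) * j) := by
      intro x j hx
      apply abs_le_of_sq_le_sq _ (by positivity)
      refine hx.trans ?_
      have hsq : ((1 + ε₀) ^ (-(5 : ℝ) * j)) ^ 2 = (1 + ε₀) ^ (-(10 : ℝ) * j) := by
        rw [sq, ← Real.rpow_add hq0]; congr 1; ring
      have hsq2 : (2 * (K ^ 15)⁻¹ * (1 + ε₀) ^ (-(5 : ℝ) * j)) ^ 2 =
          4 * ((K ^ 30)⁻¹ * (1 + ε₀) ^ (-(10 : ℝ) * j)) := by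
        rw [mul_pow, mul_pow, hsq, inv_pow, ← pow_mul]; norm_num; ring
      rw [hsq2]
      have : 0 ≤ (K ^ 30)⁻¹ * (1 + ε₀) ^ (-(10 : ℝ) * j) := by positivity
      nlinarith
    have h2 : |Xr 0 k t| ≤ 2 * (K ^ 15)⁻¹ * (1 + ε₀) ^ (-(5 : ℝ) * m) := by
      have := hp0 m hm; rw [← hk] at this; exact hsqrt this
    have h3 : Xr 3 k t ^ 2 ≤ 2 * ((K ^ 30)⁻¹ * (1 + ε₀) ^ (-(10 : ℝ) * m)) := by
      have := hp3 m hm; rwa [← hk] at this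
    have h4 : |Xr 0 (k + 1) t| ≤ 2 * (K ^ 15)⁻¹ * (1 + ε₀) ^ (-(5 : ℝ) * ((m + 1 : ℕ) : ℝ)) := by
      have := hp0 (m + 1) (by omega)
      have hidx : (1 : ℤ) + ((m + 1 : ℕ) : ℤ) = k + 1 := by rw [hk]; push_cast; ring
      rw [hidx] at this; exact hsqrt this
    have hA := abs_flux_le hε₀ hK h1 h2 h3 h4
    refine hA.trans ?_
    have hm1R : ((m - 1 : ℕ) : ℝ) = m - 1 := by rw [Nat.cast_sub (by omega)]; push_cast; ring
    have hmp1R : ((m + 1 : ℕ) : ℝ) = m + 1 := by push_cast; ring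
    -- exponent bookkeeping
    have e1 : (1 + ε₀) ^ ((5 : ℝ) * k / 2) * (1 + ε₀) ^ (-(10 : ℝ) * ((m - 1 : ℕ) : ℝ)) *
        (1 + ε₀) ^ (-(5 : ℝ) * m) ≤ (1 + ε₀) ^ ((13 : ℝ) + -(10 : ℝ) * m) :=
      rpow3_le_rpow hq1 (by rw [hkR, hm1R]; nlinarith)
    have e2 : (1 + ε₀) ^ ((5 : ℝ) * k / 2) * (1 + ε₀) ^ ((5 : ℝ) / 2) *
        (1 + ε₀) ^ (-(10 : ℝ) * m) * (1 + ε₀) ^ (-(5 : ℝ) * ((m + 1 : ℕ) : ℝ)) ≤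
        (1 + ε₀) ^ (-(10 : ℝ) * m) :=
      rpow4_le_rpow hq1 (by rw [hkR, hmp1R]; nlinarith)
    have h13 : (1 + ε₀) ^ ((13 : ℝ) + -(10 : ℝ) * m) ≤ 8192 * (1 + ε₀) ^ (-(10 : ℝ) * m) := by
      rw [Real.rpow_add hq0]
      apply mul_le_mul_of_nonneg_right _ (Real.rpow_pos_of_pos hq0 _).le
      calc (1 + ε₀) ^ (13 : ℝ) ≤ (2 : ℝ) ^ (13 : ℝ) := Real.rpow_le_rpow hq0.le hq2 (by norm_num)
        _ = 8192 := by norm_num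
    have hP : 0 < (1 + ε₀) ^ (-(10 : ℝ) * m) := Real.rpow_pos_of_pos hq0 _
    have hre : K * ((1 + ε₀) ^ ((5 : ℝ) * k / 2) *
        (2 * (K ^ 20)⁻¹ * (1 + ε₀) ^ (-(10 : ℝ) * ((m - 1 : ℕ) : ℝ)) *
          (2 * (K ^ 15)⁻¹ * (1 + ε₀) ^ (-(5 : ℝ) * m))) +
        (1 + ε₀) ^ ((5 : ℝ) * k / 2) * (1 + ε₀) ^ ((5 : ℝ) / 2) *
          (2 * ((K ^ 30)⁻¹ * (1 + ε₀) ^ (-(10 : ℝ) * m)) *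
            (2 * (K ^ 15)⁻¹ * (1 + ε₀) ^ (-(5 : ℝ) * ((m + 1 : ℕ) : ℝ))))) =
        4 * (K * ((K ^ 20)⁻¹ * (K ^ 15)⁻¹)) *
          ((1 + ε₀) ^ ((5 : ℝ) * k / 2) * (1 + ε₀) ^ (-(10 : ℝ) * ((m - 1 : ℕ) : ℝ)) *
            (1 + ε₀) ^ (-(5 : ℝ) * m)) +
        4 * (K * ((K ^ 30)⁻¹ * (K ^ 15)⁻¹)) *
          ((1 + ε₀) ^ ((5 : ℝ) * k / 2) * (1 + ε₀) ^ ((5 : ℝ) / 2) *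
            (1 + ε₀) ^ (-(10 : ℝ) * m) * (1 + ε₀) ^ (-(5 : ℝ) * ((m + 1 : ℕ) : ℝ))) := by ring
    rw [hre]
    have hK34 : K * ((K ^ 20)⁻¹ * (K ^ 15)⁻¹) = (K ^ 34)⁻¹ := by field_simp
    have hK44 : K * ((K ^ 30)⁻¹ * (K ^ 15)⁻¹) ≤ (K ^ 34)⁻¹ := by
      rw [show K * ((K ^ 30)⁻¹ * (K ^ 15)⁻¹) = (K ^ 44)⁻¹ by field_simp]
      exact inv_anti₀ (by positivity) (pow_le_pow_right₀ hK1 (by norm_num))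
    rw [hK34]
    have hK34p : 0 < (K ^ 34)⁻¹ := by positivity
    have hprod1 : 0 ≤ (1 + ε₀) ^ ((5 : ℝ) * k / 2) * (1 + ε₀) ^ ((5 : ℝ) / 2) *
        (1 + ε₀) ^ (-(10 : ℝ) * m) * (1 + ε₀) ^ (-(5 : ℝ) * ((m + 1 : ℕ) : ℝ)) := by positivity
    nlinarith [mul_le_mul_of_nonneg_right hK44 hprod1]
  -- integrate and compare
  have hint := integral_le_hundred_mul hT (by positivity) hbound
  -- `q^{-499/50} ≤ q^{-1} = 1 - ε₀/(1+ε₀) ≤ 1 - ε₀/2`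
  have hnum : (1 + ε₀) ^ (-(499 : ℝ) / 50) ≤ 1 - ε₀ / 2 := by
    calc (1 + ε₀) ^ (-(499 : ℝ) / 50) ≤ (1 + ε₀) ^ (-(1 : ℝ)) :=
          Real.rpow_le_rpow_of_exponent_le hq1 (by norm_num)
      _ = (1 + ε₀)⁻¹ := Real.rpow_neg_one _
      _ ≤ 1 - ε₀ / 2 := by
          rw [inv_le_iff_one_le_mul₀ hq0]; nlinarith
  have hP : 0 < (1 + ε₀) ^ (-(10 : ℝ) * m) := Real.rpow_pos_of_pos hq0 _
  have hK30pos : 0 < (K ^ 30)⁻¹ := by positivity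
  -- `3.3·10⁶ K^{-34} < (ε₀/2) K^{-30}` from `10⁸ ≤ ε₀ K⁴`
  have hkey : 3300000 * (K ^ 34)⁻¹ < ε₀ / 2 * (K ^ 30)⁻¹ := by
    have h34 : (K ^ 34)⁻¹ = (K ^ 4)⁻¹ * (K ^ 30)⁻¹ := by rw [← mul_inv, ← pow_add]
    have h4 : 3300000 * (K ^ 4)⁻¹ < ε₀ / 2 := by
      rw [← div_eq_mul_inv, div_lt_iff₀ (by positivity)]
      nlinarith
    calc 3300000 * (K ^ 34)⁻¹ = (3300000 * (K ^ 4)⁻¹) * (K ^ 30)⁻¹ := by rw [h34]; ring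
      _ < ε₀ / 2 * (K ^ 30)⁻¹ := mul_lt_mul_of_pos_right h4 hK30pos
  have hflux : Er k T ≤ Er k 0 + ∫ t in (0 : ℝ)..T, flux ε₀ K Xr k t := hineq
  have hEk0 : Er k 0 ≤ (1 - ε₀ / 2) * ((K ^ 30)⁻¹ * (1 + ε₀) ^ (-(10 : ℝ) * m)) := by
    rw [hk]
    exact hinit.trans (mul_le_mul_of_nonneg_right hnum (by positivity))
  have hstrict := mul_lt_mul_of_pos_right hkey hP
  linarith [hflux, hEk0, hint, hstrict]

/-! ## Corollary 6.11: the exit trichotomy -/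

/-- **Corollary 6.11 (exit trichotomy).** Under the standing largeness (`10⁸ ≤ ε₀K⁴`, `ε ≤ 1`,
`n₀` large), at least one of: `Ẽ_{-1}(T₁) = K^{-10}(1+ε₀)^{2/10}` (backwards flow of energy),
`|d_1(T₁)| = ½K^{-10}` (forwards flow of energy), `T₁ = 100` (running out the clock).
[cite: Tao2016AveragedNS, §6.5 Cor. 6.11] -/
theorem RescaledHypotheses.exit_trichotomy
    (h : RescaledHypotheses γ ε₀ K ε C₁ C₂ C₃ n₀ N τ Xr Er) (hε₀ : 0 < ε₀) (hε₀1 : ε₀ < 1)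
    (hγ1 : γ ≤ 1 / 10 ^ 5) (hK : 0 < K) (hKε : 10 ^ 8 ≤ ε₀ * K ^ 4) (hε : 0 < ε) (hε1 : ε ≤ 1)
    (hC₂ : 0 ≤ C₂) (hC₃ : 0 ≤ C₃) (hN : n₀ ≤ N)
    (hn : C₂ * (1 + ε₀) ^ (-(n₀ : ℝ) / 2) * cumEnergyConst ε₀ C₃ ≤ 1 / 100) :
    Er (-1) (T1 ε₀ K Xr Er) = (K ^ 10)⁻¹ * (1 + ε₀) ^ ((2 : ℝ) / 10) ∨
      |Xr 3 1 (T1 ε₀ K Xr Er)| = 1 / 2 * (K ^ 10)⁻¹ ∨ T1 ε₀ K Xr Er = 100 := by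
  have hK100 := hundred_le_of_regime hε₀1 hK hKε
  have hK2 : (2 : ℝ) ≤ K := by linarith
  have g0 := h.goodAt_zero hε₀ hε₀1 hγ1 hK2 hε hε1 hC₂ hC₃ hN hn
  have hT := T1_mem g0
  have hgood : ∀ t ∈ Icc 0 (T1 ε₀ K Xr Er), GoodAt ε₀ K Xr Er t := fun t ht =>
    h.goodAt_of_mem_T1 hN g0 ht
  rcases T1_exit g0 with h100 | hnot
  · exact Or.inr (Or.inr h100)
  · by_contra hcon
    push Not at hcon
    obtain ⟨hE, hd, -⟩ := hcon
    have gT := hgood _ ⟨hT.1, le_rfl⟩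
    apply hnot
    apply h.eventually_goodAt_of_strict hε₀ hK hN hT
    · intro m hm
      rcases Nat.lt_or_ge m 3 with hm3 | hm3
      · obtain rfl : m = 2 := by omega
        have hle := gT.before 2 le_rfl
        have hidx : (1 : ℤ) - ((2 : ℕ) : ℤ) = -1 := by norm_num
        rw [hidx] at hle ⊢
        have hexp : (((2 : ℕ) : ℝ)) / 10 = (2 : ℝ) / 10 := by norm_num
        rw [hexp] at hle ⊢
        exact lt_of_le_of_ne hle hE
      · exact h.exit_far hε₀ hε₀1 hK hKε hN hT hgood m hm3
    · exact h.exit_near hε₀ hε₀1 hγ1 hK hKε hε hε1 hC₂ hC₃ hN hn hT hgood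
    · exact fun m hm => h.exit_far2 hε₀ hε₀1 hK hKε hN hT hgood m hm
    · exact lt_of_le_of_ne gT.d_le hd

end Exit

end TaoCascade

end Literature.Analysis.FluidPDE
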